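import Mathlib.Data.Real.Basic
import Mathlib.Data.Matrix.Basic
import Mathlib.Tactic.Linarith
import Mathlib.Tactic.Ring
import Mathlib.Tactic.Positivity

/-!
# `MatrixDescartes` census — the SIGNATURE LEMMA for the Lorentz form on `Sym₂(ℝ)` (W4 «tropical twenties», edge level)

HONEST FRAMING.  Object-search cell `pub-symmetroid`, item `DoorA26 = PosRootLawAt 2 6 19` (stmt-ValiantsHypothesis-19979,
OPEN, typed, never asserted).  The W4 line (engine-1 g17–g19: notes TROPFAN-W4-E1G17, CAPACITY09-E1G18, TWOROW-E1G19) studies the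
DEGENERATIONS of HYPOTHETICAL Descartes-sharp symmetric `2 × 2` six-term pencils.  On a hull edge of such a degeneration the limit
coefficient letters `Ŝ_l` form a Gram configuration for the polarised determinant form
`B(S,T) = S₀₀T₁₁ + S₁₁T₀₀ − 2 S₀₁T₀₁` (twice the Lorentz pairing on `Sym₂(ℝ) ≅ ℝ^{1,2}`, `B(S,S) = 2 det S`), with prescribed
vanishing off the edge.  The one linear-algebra fact used to kill edges on the `−1`-oriented cells (TWOROW-E1G19 §9b) is typed here:

* `det_nonpos_of_polar_isotropic` — if `S ≠ 0` is ISOTROPIC (`det S = 0`) and `T` is `B`-orthogonal to `S`, then `det T ≤ 0`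
  («the orthogonal complement of a non-zero isotropic vector of `ℝ^{1,2}` is negative semi-definite»);
* `polar_ne_zero_of_det_pos` — contrapositive reading: a DEFINITE letter (`det T > 0`) is never `B`-orthogonal to a non-zero
  isotropic letter;
* `det_nonpos_of_orth_isotropic_real` — the same with six real numbers, and the two polynomial identities behind it.

Only the entries `·00, ·01, ·11` are used (the letters are meant symmetric; `·10` never enters).  Nothing here is a certificate
about any support, nothing bounds `ζ_sym(2,6)`, nothing bears on the crux `MatrixDescartes` (stmt-ValiantsHypothesis-18050) or on
`VP ≠ VNP`. [folklore] Elementary algebra.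
-/

-- `Summit.ValiantsHypothesis.ValiantsHypothesis.…` repeats a component by the D-0017 layout
-- (single-conjunct summit), which the `dupNamespace` linter flags; the name is mandated.
set_option linter.dupNamespace false

namespace Summit.ValiantsHypothesis.ValiantsHypothesis.Theorems.LacunarySymmetroidMatrixDescartes.Census

/-- First polynomial identity behind the signature lemma: with `p r - q² = 0` and `p c + r a - 2 q b = 0` it reads
`p² (b² − a c) = (p b − q a)²`. [folklore] -/
theorem sq_mul_discr_eq_left (p q r a b c : ℝ) :
    p ^ 2 * (b ^ 2 - a * c) = (p * b - q * a) ^ 2 + a ^ 2 * (p * r - q ^ 2) - a * p * (p * c + r * a - 2 * q * b) := by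
  ring

/-- Second polynomial identity behind the signature lemma: with `p r - q² = 0` and `p c + r a - 2 q b = 0` it reads
`r² (b² − a c) = (r b − q c)²`. [folklore] -/
theorem sq_mul_discr_eq_right (p q r a b c : ℝ) :
    r ^ 2 * (b ^ 2 - a * c) = (r * b - q * c) ^ 2 + c ^ 2 * (p * r - q ^ 2) - c * r * (p * c + r * a - 2 * q * b) := by
  ring

/-- **Signature lemma, scalar form.**  If `(p, q, r) ≠ 0` is isotropic for the form `p r − q²` and `(a, b, c)` is orthogonal to
it for the polarisation `p c + r a − 2 q b`, then `a c − b² ≤ 0`: the orthogonal complement of a non-zero isotropic vector of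
`ℝ^{1,2}` is negative semi-definite. [folklore] -/
theorem det_nonpos_of_orth_isotropic_real (p q r a b c : ℝ) (hiso : p * r - q ^ 2 = 0)
    (hne : ¬ (p = 0 ∧ q = 0 ∧ r = 0)) (horth : p * c + r * a - 2 * q * b = 0) :
    a * c - b ^ 2 ≤ 0 := by
  have h1 : p ^ 2 * (b ^ 2 - a * c) = (p * b - q * a) ^ 2 := by
    rw [sq_mul_discr_eq_left, hiso, horth]; ring
  have h2 : r ^ 2 * (b ^ 2 - a * c) = (r * b - q * c) ^ 2 := by
    rw [sq_mul_discr_eq_right, hiso, horth]; ring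
  have hsum : (p ^ 2 + r ^ 2) * (b ^ 2 - a * c) = (p * b - q * a) ^ 2 + (r * b - q * c) ^ 2 := by
    rw [add_mul, h1, h2]
  by_cases hpr : p ^ 2 + r ^ 2 = 0
  · have hp : p = 0 := by nlinarith [sq_nonneg p, sq_nonneg r]
    have hr : r = 0 := by nlinarith [sq_nonneg p, sq_nonneg r]
    have hq : q = 0 := by
      have : q ^ 2 = 0 := by rw [hp, hr] at hiso; linarith
      exact pow_eq_zero_iff (n := 2) (by norm_num) |>.mp this
    exact absurd ⟨hp, hq, hr⟩ hne
  · have hpos : 0 < p ^ 2 + r ^ 2 := lt_of_le_of_ne (by positivity) (Ne.symm hpr)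
    have hnn : 0 ≤ (p ^ 2 + r ^ 2) * (b ^ 2 - a * c) := by rw [hsum]; positivity
    have : 0 ≤ b ^ 2 - a * c := (mul_nonneg_iff_of_pos_left hpos).mp hnn
    linarith

/-- **Signature lemma, matrix form** (entries `00, 01, 11` of `2 × 2` real matrices; the letters are meant symmetric).  If `S` is a
non-zero isotropic letter (`S₀₀S₁₁ − S₀₁² = 0`) and `T` is orthogonal to `S` for the polarised determinant form
`B(S,T) = S₀₀T₁₁ + S₁₁T₀₀ − 2 S₀₁T₀₁`, then `T₀₀T₁₁ − T₀₁² ≤ 0`.  Used in TWOROW-E1G19 §9b: on a `−1`-oriented cell an end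
degeneration cannot reach past the first DEFINITE letter. [folklore] -/
theorem det_nonpos_of_polar_isotropic (S T : Matrix (Fin 2) (Fin 2) ℝ)
    (hiso : S 0 0 * S 1 1 - S 0 1 ^ 2 = 0) (hne : ¬ (S 0 0 = 0 ∧ S 0 1 = 0 ∧ S 1 1 = 0))
    (horth : S 0 0 * T 1 1 + S 1 1 * T 0 0 - 2 * (S 0 1 * T 0 1) = 0) :
    T 0 0 * T 1 1 - T 0 1 ^ 2 ≤ 0 :=
  det_nonpos_of_orth_isotropic_real (S 0 0) (S 0 1) (S 1 1) (T 0 0) (T 0 1) (T 1 1) hiso hne (by linarith)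

/-- Contrapositive reading: a DEFINITE letter `T` (`T₀₀T₁₁ − T₀₁² > 0`) is never `B`-orthogonal to a non-zero isotropic letter
`S`. [folklore] -/
theorem polar_ne_zero_of_det_pos (S T : Matrix (Fin 2) (Fin 2) ℝ)
    (hiso : S 0 0 * S 1 1 - S 0 1 ^ 2 = 0) (hne : ¬ (S 0 0 = 0 ∧ S 0 1 = 0 ∧ S 1 1 = 0))
    (hdef : 0 < T 0 0 * T 1 1 - T 0 1 ^ 2) :
    S 0 0 * T 1 1 + S 1 1 * T 0 0 - 2 * (S 0 1 * T 0 1) ≠ 0 := by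
  intro h
  have := det_nonpos_of_polar_isotropic S T hiso hne h
  linarith

end Summit.ValiantsHypothesis.ValiantsHypothesis.Theorems.LacunarySymmetroidMatrixDescartes.Census
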